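import Summits.NavierStokesRegularity.NavierStokesRegularity.Theorems.CoriolisHeadLocalEnergyPhysicalField
import Summits.NavierStokesRegularity.NavierStokesRegularity.Theorems.CoriolisHeadLocalEnergyDensity
import HarnessLib

/-!
# CoriolisHeadLocalEnergyPhysicalSlices — crux `NoCoRotatingCore` (stmt-NavierStokesRegularity-22676), line
# `local_energy_rescue` v2.1 (crux workfile, ns-idea-10 g3; unregistered), stub S3a `stub_localEnergyClass` —
# file 2: the slices of the general-frame physical field in similarity variables

For the PHYSICAL rotated self-similar field `u(t,x) = λ e^{θB} U(λ e^{−θB} x)` (`λ = (√(2a(0−t)))⁻¹`, `θ = a⁻¹ log λ`,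
`B` skew) of a general-frame profile `U` and a pressure `p(t,x) = λ² P(λ e^{−θB} x)` (`t < 0`), this file reads the
ball integrals entering the physical local energy identity against a fixed cut-off in similarity variables (change
of variables `x = λ⁻¹ e^{θB} y`, Jacobian `λ⁻³`, centre `z_t = λ e^{−θB} x₀`, radius `λr`; `e^{±θB}` are linear
isometries, tree `rss_exists_rot`):

* `setIntegral_ball_norm_sq_physicalField` (`= λ⁻¹ ∫_{B(z_t, λr)} ‖U‖²`), `setIntegral_ball_norm_cube_physicalField`
  (`= ∫ ‖U‖³`), `setIntegral_ball_pressure_physicalField` (`∫ |p − λ²m|‖u‖ = ∫ |P − m|‖U‖`);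
* `flux_physicalField_le` — the flux of one slice through a translated cut-off (tree
  `IsClassicalNSSolutionOn.integral_flux_le`) bounded by `Bνλ⁻¹∫_{B(z_t,λR)}‖U‖² + B∫‖U‖³ + 2B∫|P − m|‖U‖`;
* `inv_mul_setIntegral_le_integral_cutoff_physicalField`, `integral_cutoff_physicalField_le` — the bottom and the top
  of the energy identity in similarity variables.

The general-frame twin of `CoriolisHeadLocalEnergyDensitySlices` (there: Pineau–Vicol normal form, `rotZ`).

HONEST FRAMING.  Helper for an unregistered line's stub (S3a); nothing here proves `NoCoRotatingCore` or NS regularity.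

References: D. Chae, J. Wolf, arXiv:1610.09464, §2 Step 2 (2.4f) [ChaeWolf2017RemovingDSS]; L. Caffarelli, R. Kohn,
L. Nirenberg, CPAM 35 (1982) §2 (2.5) [CaffarelliKohnNirenberg1982]; line card `Lines/local_energy_rescue.md` (S3a).
-/

noncomputable section

open MeasureTheory Set Function Filter Topology Metric InnerProductSpace Real
open scoped RealInnerProductSpace Laplacian ContDiff Topology

-- the summit and its single sub-problem share the name (CONVENTIONS §1), as in every Theorems file
set_option linter.dupNamespace false
-- nested operator types `ℝ³ →L[ℝ] ℝ³` inside the Banach algebra `ℝ³ →L[ℝ] ℝ³` (as in `CoriolisHeadTypeIRateTransport`)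
set_option maxSynthPendingDepth 3

namespace Summit.NavierStokesRegularity.NavierStokesRegularity.Theorems.CoriolisHead

namespace LocalEnergyRescue

open Literature.Analysis.FluidPDE

section Slices

variable {ν a : ℝ} {B : EuclideanSpace ℝ (Fin 3) →L[ℝ] EuclideanSpace ℝ (Fin 3)}
  {U : EuclideanSpace ℝ (Fin 3) → EuclideanSpace ℝ (Fin 3)} {P : EuclideanSpace ℝ (Fin 3) → ℝ}
  {u : ℝ → EuclideanSpace ℝ (Fin 3) → EuclideanSpace ℝ (Fin 3)} {p : ℝ → EuclideanSpace ℝ (Fin 3) → ℝ}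

/-! ## §1 The change of variables `x = λ⁻¹ e^{θB} y` -/

/-- The scale `λ(t) = (√(2a(0−t)))⁻¹` is positive for `t < 0`. [folklore] -/
theorem scale_pos (ha : 0 < a) {t : ℝ} (ht : t < 0) : 0 < (Real.sqrt (2 * a * (0 - t)))⁻¹ :=
  inv_pos.2 (Real.sqrt_pos.2 (by nlinarith))

/-- **Change of variables for the physical field**: for a linear isometry `L` with `L = e^{−θB}` and
`λ > 0`, `∫_{B(x₀,r)} g(λ e^{−θB} x) dx = λ⁻³ ∫_{B(λ L x₀, rλ)} g(y) dy`. [folklore] -/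
theorem setIntegral_ball_comp_scale_rot (g : EuclideanSpace ℝ (Fin 3) → ℝ) {lam θ : ℝ} (hlam : 0 < lam)
    (L : EuclideanSpace ℝ (Fin 3) ≃ₗᵢ[ℝ] EuclideanSpace ℝ (Fin 3))
    (hL : ∀ y, L y = NormedSpace.exp ((-θ) • B) y)
    (x₀ : EuclideanSpace ℝ (Fin 3)) (r : ℝ) :
    ∫ x in ball x₀ r, g (lam • NormedSpace.exp ((-θ) • B) x) =
      (lam ^ 3)⁻¹ * ∫ y in ball (lam • L x₀) (r * lam), g y := by
  have h := setIntegral_ball_comp_smul_isometry (fun x => g (lam • NormedSpace.exp ((-θ) • B) x)) (inv_pos.2 hlam)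
    L.symm x₀ r
  rw [inv_inv, LinearIsometryEquiv.symm_symm, div_eq_mul_inv, inv_inv] at h
  rw [h, inv_pow]
  congr 1
  refine setIntegral_congr_fun measurableSet_ball fun y _ => ?_
  rw [← hL, L.map_smul, smul_smul, mul_inv_cancel₀ hlam.ne', one_smul, LinearIsometryEquiv.apply_symm_apply]

/-! ## §2 Ball integrals of the slices -/

/-- **Local energy of a slice**: `∫_{B(x₀,r)} ‖u(t)‖² = λ⁻¹ ∫_{B(z_t, rλ)} ‖U‖²`, `z_t = λ e^{−θB} x₀`.
[cite: ChaeWolf2017RemovingDSS, §2 (2.4f) (arXiv p. 5)] -/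
theorem setIntegral_ball_norm_sq_physicalField (ha : 0 < a) (hB : ∀ x, inner ℝ (B x) x = 0)
    (hu : ∀ (t : ℝ) (x : EuclideanSpace ℝ (Fin 3)), u t x =
      (Real.sqrt (2 * a * (0 - t)))⁻¹ • (NormedSpace.exp ((a⁻¹ * Real.log (Real.sqrt (2 * a * (0 - t)))⁻¹) • B))
        (U ((Real.sqrt (2 * a * (0 - t)))⁻¹ •
          (NormedSpace.exp ((-(a⁻¹ * Real.log (Real.sqrt (2 * a * (0 - t)))⁻¹)) • B)) x)))
    {t : ℝ} (ht : t < 0) (x₀ : EuclideanSpace ℝ (Fin 3)) (r : ℝ) :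
    ∫ x in ball x₀ r, ‖u t x‖ ^ 2 =
      ((Real.sqrt (2 * a * (0 - t)))⁻¹)⁻¹ *
        ∫ y in ball ((Real.sqrt (2 * a * (0 - t)))⁻¹ •
          NormedSpace.exp ((-(a⁻¹ * Real.log (Real.sqrt (2 * a * (0 - t)))⁻¹)) • B) x₀)
          (r * (Real.sqrt (2 * a * (0 - t)))⁻¹), ‖U y‖ ^ 2 := by
  set lam : ℝ := (Real.sqrt (2 * a * (0 - t)))⁻¹ with hlam
  set θ : ℝ := a⁻¹ * Real.log lam with hθ
  have hlam0 : 0 < lam := scale_pos ha ht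
  obtain ⟨L, hL, -⟩ := rss_exists_rot hB θ
  have e : ∀ x, ‖u t x‖ ^ 2 = (fun y => lam ^ 2 * ‖U y‖ ^ 2) (lam • NormedSpace.exp ((-θ) • B) x) := fun x => by
    simp only []
    rw [hu t x, ← hlam, ← hθ, norm_smul, Real.norm_of_nonneg hlam0.le, TypeIRate.norm_exp_smul_skew hB, mul_pow]
  simp_rw [e]
  rw [setIntegral_ball_comp_scale_rot (fun y => lam ^ 2 * ‖U y‖ ^ 2) hlam0 L hL, integral_const_mul,
    ← mul_assoc, hL x₀]
  congr 1
  field_simp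

/-- **Cubic term of a slice**: `∫_{B(x₀,r)} ‖u(t)‖³ = ∫_{B(z_t, rλ)} ‖U‖³` (scale invariant). [folklore] -/
theorem setIntegral_ball_norm_cube_physicalField (ha : 0 < a) (hB : ∀ x, inner ℝ (B x) x = 0)
    (hu : ∀ (t : ℝ) (x : EuclideanSpace ℝ (Fin 3)), u t x =
      (Real.sqrt (2 * a * (0 - t)))⁻¹ • (NormedSpace.exp ((a⁻¹ * Real.log (Real.sqrt (2 * a * (0 - t)))⁻¹) • B))
        (U ((Real.sqrt (2 * a * (0 - t)))⁻¹ •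
          (NormedSpace.exp ((-(a⁻¹ * Real.log (Real.sqrt (2 * a * (0 - t)))⁻¹)) • B)) x)))
    {t : ℝ} (ht : t < 0) (x₀ : EuclideanSpace ℝ (Fin 3)) (r : ℝ) :
    ∫ x in ball x₀ r, ‖u t x‖ ^ 3 =
      ∫ y in ball ((Real.sqrt (2 * a * (0 - t)))⁻¹ •
          NormedSpace.exp ((-(a⁻¹ * Real.log (Real.sqrt (2 * a * (0 - t)))⁻¹)) • B) x₀)
          (r * (Real.sqrt (2 * a * (0 - t)))⁻¹), ‖U y‖ ^ 3 := by
  set lam : ℝ := (Real.sqrt (2 * a * (0 - t)))⁻¹ with hlam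
  set θ : ℝ := a⁻¹ * Real.log lam with hθ
  have hlam0 : 0 < lam := scale_pos ha ht
  obtain ⟨L, hL, -⟩ := rss_exists_rot hB θ
  have e : ∀ x, ‖u t x‖ ^ 3 = (fun y => lam ^ 3 * ‖U y‖ ^ 3) (lam • NormedSpace.exp ((-θ) • B) x) := fun x => by
    simp only []
    rw [hu t x, ← hlam, ← hθ, norm_smul, Real.norm_of_nonneg hlam0.le, TypeIRate.norm_exp_smul_skew hB, mul_pow]
  simp_rw [e]
  rw [setIntegral_ball_comp_scale_rot (fun y => lam ^ 3 * ‖U y‖ ^ 3) hlam0 L hL, integral_const_mul,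
    ← mul_assoc, inv_mul_cancel₀ (by positivity), one_mul, hL x₀]

/-- **Pressure flux of a slice, gauged**: for `p(t,x) = λ² P(λ e^{−θB} x)`,
`∫_{B(x₀,r)} |p(t) − λ²m| ‖u(t)‖ = ∫_{B(z_t, rλ)} |P − m| ‖U‖` (scale invariant). [folklore] -/
theorem setIntegral_ball_pressure_physicalField (ha : 0 < a) (hB : ∀ x, inner ℝ (B x) x = 0)
    (hu : ∀ (t : ℝ) (x : EuclideanSpace ℝ (Fin 3)), u t x =
      (Real.sqrt (2 * a * (0 - t)))⁻¹ • (NormedSpace.exp ((a⁻¹ * Real.log (Real.sqrt (2 * a * (0 - t)))⁻¹) • B))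
        (U ((Real.sqrt (2 * a * (0 - t)))⁻¹ •
          (NormedSpace.exp ((-(a⁻¹ * Real.log (Real.sqrt (2 * a * (0 - t)))⁻¹)) • B)) x)))
    {t : ℝ} (ht : t < 0)
    (hp : ∀ x : EuclideanSpace ℝ (Fin 3), p t x = (Real.sqrt (2 * a * (0 - t)))⁻¹ ^ 2 *
      P ((Real.sqrt (2 * a * (0 - t)))⁻¹ •
        (NormedSpace.exp ((-(a⁻¹ * Real.log (Real.sqrt (2 * a * (0 - t)))⁻¹)) • B)) x))
    (x₀ : EuclideanSpace ℝ (Fin 3)) (r m : ℝ) :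
    ∫ x in ball x₀ r, |p t x - (Real.sqrt (2 * a * (0 - t)))⁻¹ ^ 2 * m| * ‖u t x‖ =
      ∫ y in ball ((Real.sqrt (2 * a * (0 - t)))⁻¹ •
          NormedSpace.exp ((-(a⁻¹ * Real.log (Real.sqrt (2 * a * (0 - t)))⁻¹)) • B) x₀)
          (r * (Real.sqrt (2 * a * (0 - t)))⁻¹), |P y - m| * ‖U y‖ := by
  set lam : ℝ := (Real.sqrt (2 * a * (0 - t)))⁻¹ with hlam
  set θ : ℝ := a⁻¹ * Real.log lam with hθ
  have hlam0 : 0 < lam := scale_pos ha ht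
  obtain ⟨L, hL, -⟩ := rss_exists_rot hB θ
  have e : ∀ x, |p t x - lam ^ 2 * m| * ‖u t x‖ =
      (fun y => lam ^ 3 * (|P y - m| * ‖U y‖)) (lam • NormedSpace.exp ((-θ) • B) x) := fun x => by
    simp only []
    rw [hu t x, hp x, ← hlam, ← hθ, norm_smul, Real.norm_of_nonneg hlam0.le, TypeIRate.norm_exp_smul_skew hB,
      ← mul_sub, abs_mul, abs_of_pos (by positivity : (0 : ℝ) < lam ^ 2)]
    ring
  simp_rw [e]
  rw [setIntegral_ball_comp_scale_rot (fun y => lam ^ 3 * (|P y - m| * ‖U y‖)) hlam0 L hL,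
    integral_const_mul, ← mul_assoc, inv_mul_cancel₀ (by positivity), one_mul, hL x₀]

/-! ## §3 The flux of a slice through a translated cut-off -/

/-- **The flux of one slice, in similarity variables.**  Let `(u, p)` be a classical solution (viscosity `ν ≥ 0`,
unforced) on `(−∞, 0)` with `u` the physical field of `U` and `p(t) = λ²P(λe^{−θB}·)`, `φ` a test function with
`‖Dφ‖, |Δφ| ≤ B₀` vanishing off `B(x₀, R)`.  For `t < 0`, with `z = λ e^{−θB} x₀`, `ρ = Rλ` and any gauge `m`:
`∫ (νΔφ|u|² + Dφ(u)|u|² + 2pDφ(u)) ≤ B₀ ν λ⁻¹ ∫_{B(z,ρ)}‖U‖² + B₀ ∫_{B(z,ρ)}‖U‖³ + 2B₀ ∫_{B(z,ρ)}|P − m|‖U‖`.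
[cite: ChaeWolf2017RemovingDSS, §2 Step 2 (2.4f) (arXiv p. 5)] -/
theorem flux_physicalField_le (hν : 0 ≤ ν) (ha : 0 < a) (hB : ∀ x, inner ℝ (B x) x = 0)
    (hu : ∀ (t : ℝ) (x : EuclideanSpace ℝ (Fin 3)), u t x =
      (Real.sqrt (2 * a * (0 - t)))⁻¹ • (NormedSpace.exp ((a⁻¹ * Real.log (Real.sqrt (2 * a * (0 - t)))⁻¹) • B))
        (U ((Real.sqrt (2 * a * (0 - t)))⁻¹ •
          (NormedSpace.exp ((-(a⁻¹ * Real.log (Real.sqrt (2 * a * (0 - t)))⁻¹)) • B)) x)))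
    (hNS : IsClassicalNSSolutionOn (Iio 0) ν 0 u p)
    {φ : EuclideanSpace ℝ (Fin 3) → ℝ} (hφ : ContDiff ℝ ∞ φ) (hφc : HasCompactSupport φ)
    {x₀ : EuclideanSpace ℝ (Fin 3)} {R B₀ : ℝ}
    (hDφ : ∀ x, ‖fderiv ℝ φ x‖ ≤ B₀) (hΔφ : ∀ x, |(Δ φ) x| ≤ B₀)
    (hD0 : ∀ x, x ∉ ball x₀ R → fderiv ℝ φ x = 0) (hΔ0 : ∀ x, x ∉ ball x₀ R → (Δ φ) x = 0)
    {t : ℝ} (ht : t < 0)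
    (hp : ∀ x : EuclideanSpace ℝ (Fin 3), p t x = (Real.sqrt (2 * a * (0 - t)))⁻¹ ^ 2 *
      P ((Real.sqrt (2 * a * (0 - t)))⁻¹ •
        (NormedSpace.exp ((-(a⁻¹ * Real.log (Real.sqrt (2 * a * (0 - t)))⁻¹)) • B)) x))
    (m : ℝ) :
    ∫ x, (ν * ((Δ φ) x * ‖u t x‖ ^ 2) + fderiv ℝ φ x (u t x) * ‖u t x‖ ^ 2 +
        2 * (p t x * fderiv ℝ φ x (u t x))) ≤
      B₀ * (ν * (((Real.sqrt (2 * a * (0 - t)))⁻¹)⁻¹ *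
        ∫ y in ball ((Real.sqrt (2 * a * (0 - t)))⁻¹ •
          NormedSpace.exp ((-(a⁻¹ * Real.log (Real.sqrt (2 * a * (0 - t)))⁻¹)) • B) x₀)
          (R * (Real.sqrt (2 * a * (0 - t)))⁻¹), ‖U y‖ ^ 2)) +
      B₀ * (∫ y in ball ((Real.sqrt (2 * a * (0 - t)))⁻¹ •
          NormedSpace.exp ((-(a⁻¹ * Real.log (Real.sqrt (2 * a * (0 - t)))⁻¹)) • B) x₀)
          (R * (Real.sqrt (2 * a * (0 - t)))⁻¹), ‖U y‖ ^ 3) +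
      2 * B₀ * (∫ y in ball ((Real.sqrt (2 * a * (0 - t)))⁻¹ •
          NormedSpace.exp ((-(a⁻¹ * Real.log (Real.sqrt (2 * a * (0 - t)))⁻¹)) • B) x₀)
          (R * (Real.sqrt (2 * a * (0 - t)))⁻¹), |P y - m| * ‖U y‖) := by
  have hB0 : 0 ≤ B₀ := (norm_nonneg _).trans (hDφ x₀)
  have ht' : t ∈ Iio (0 : ℝ) := ht
  -- the tree's gauged flux bound
  have hflux := hNS.integral_flux_le hφ hφc ht' ((Real.sqrt (2 * a * (0 - t)))⁻¹ ^ 2 * m)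
  rw [abs_of_nonneg hν] at hflux
  have hu_c : Continuous (u t) := (hNS.contDiff_velocity ht').continuous
  have hp_c : Continuous (p t) := (hNS.contDiff_pressure ht').continuous
  have hφ2 : ContDiff ℝ 2 φ := hφ.of_le (by norm_cast)
  have hφ1 : ContDiff ℝ 1 φ := hφ.of_le (by norm_cast)
  have hΔc : Continuous (Δ φ) := continuous_laplacian hφ2
  have hDc : Continuous (fderiv ℝ φ) := hφ1.continuous_fderiv one_ne_zero
  have hout : ∀ x, x ∉ closedBall x₀ R → x ∉ ball x₀ R := fun x hx h => hx (ball_subset_closedBall h)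
  have h1 : ∫ x, |(Δ φ) x| * ‖u t x‖ ^ 2 ≤ B₀ * ∫ x in ball x₀ R, ‖u t x‖ ^ 2 := by
    have cW : Continuous fun x => |(Δ φ) x| * ‖u t x‖ ^ 2 := (continuous_abs.comp hΔc).mul (hu_c.norm.pow 2)
    have cg : Continuous fun x => ‖u t x‖ ^ 2 := hu_c.norm.pow 2
    refine integral_weight_mul_le (fun x => by rw [abs_abs]; exact hΔφ x)
      (fun x hx => by rw [hΔ0 x hx, abs_zero]) cg (fun x => by positivity) ?_
    refine cW.integrable_of_hasCompactSupport
      (HasCompactSupport.intro (K := closedBall x₀ R) (isCompact_closedBall x₀ R) fun x hx => ?_)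
    show |(Δ φ) x| * ‖u t x‖ ^ 2 = 0
    rw [hΔ0 x (hout x hx), abs_zero, zero_mul]
  have h2 : ∫ x, ‖fderiv ℝ φ x‖ * ‖u t x‖ ^ 3 ≤ B₀ * ∫ x in ball x₀ R, ‖u t x‖ ^ 3 := by
    have cW : Continuous fun x => ‖fderiv ℝ φ x‖ * ‖u t x‖ ^ 3 := hDc.norm.mul (hu_c.norm.pow 3)
    have cg : Continuous fun x => ‖u t x‖ ^ 3 := hu_c.norm.pow 3
    refine integral_weight_mul_le (fun x => by rw [abs_norm]; exact hDφ x)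
      (fun x hx => by rw [hD0 x hx, norm_zero]) cg (fun x => by positivity) ?_
    refine cW.integrable_of_hasCompactSupport
      (HasCompactSupport.intro (K := closedBall x₀ R) (isCompact_closedBall x₀ R) fun x hx => ?_)
    show ‖fderiv ℝ φ x‖ * ‖u t x‖ ^ 3 = 0
    rw [hD0 x (hout x hx), norm_zero, zero_mul]
  have h3 : ∫ x, |p t x - (Real.sqrt (2 * a * (0 - t)))⁻¹ ^ 2 * m| * ‖fderiv ℝ φ x‖ * ‖u t x‖ ≤
      B₀ * ∫ x in ball x₀ R, |p t x - (Real.sqrt (2 * a * (0 - t)))⁻¹ ^ 2 * m| * ‖u t x‖ := by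
    have e : ∀ x, |p t x - (Real.sqrt (2 * a * (0 - t)))⁻¹ ^ 2 * m| * ‖fderiv ℝ φ x‖ * ‖u t x‖ =
        ‖fderiv ℝ φ x‖ * (|p t x - (Real.sqrt (2 * a * (0 - t)))⁻¹ ^ 2 * m| * ‖u t x‖) := fun x => by ring
    simp_rw [e]
    have cg : Continuous fun x => |p t x - (Real.sqrt (2 * a * (0 - t)))⁻¹ ^ 2 * m| * ‖u t x‖ :=
      (continuous_abs.comp (hp_c.sub continuous_const)).mul hu_c.norm
    have cW : Continuous fun x => ‖fderiv ℝ φ x‖ *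
        (|p t x - (Real.sqrt (2 * a * (0 - t)))⁻¹ ^ 2 * m| * ‖u t x‖) := hDc.norm.mul cg
    refine integral_weight_mul_le (fun x => by rw [abs_norm]; exact hDφ x)
      (fun x hx => by rw [hD0 x hx, norm_zero]) cg (fun x => by positivity) ?_
    refine cW.integrable_of_hasCompactSupport
      (HasCompactSupport.intro (K := closedBall x₀ R) (isCompact_closedBall x₀ R) fun x hx => ?_)
    show ‖fderiv ℝ φ x‖ * (|p t x - (Real.sqrt (2 * a * (0 - t)))⁻¹ ^ 2 * m| * ‖u t x‖) = 0
    rw [hD0 x (hout x hx), norm_zero, zero_mul]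
  -- read the three ball integrals in similarity variables
  rw [setIntegral_ball_norm_sq_physicalField ha hB hu ht] at h1
  rw [setIntegral_ball_norm_cube_physicalField ha hB hu ht] at h2
  rw [setIntegral_ball_pressure_physicalField ha hB hu ht hp] at h3
  have hν1 := mul_le_mul_of_nonneg_left h1 hν
  linarith [hflux, hν1, h2, h3]

/-! ## §4 The bottom and the top of the energy identity -/

/-- **The local energy of a slice dominates the profile energy of the inner ball**: if `0 ≤ φ` and `φ = 1` on
`B(x₀, 1)` then `λ⁻¹ ∫_{B(z_t, λ)} ‖U‖² ≤ ∫ φ‖u(t)‖²`, `z_t = λ e^{−θB} x₀`. [folklore] -/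
theorem inv_mul_setIntegral_le_integral_cutoff_physicalField (ha : 0 < a) (hB : ∀ x, inner ℝ (B x) x = 0)
    (hu : ∀ (t : ℝ) (x : EuclideanSpace ℝ (Fin 3)), u t x =
      (Real.sqrt (2 * a * (0 - t)))⁻¹ • (NormedSpace.exp ((a⁻¹ * Real.log (Real.sqrt (2 * a * (0 - t)))⁻¹) • B))
        (U ((Real.sqrt (2 * a * (0 - t)))⁻¹ •
          (NormedSpace.exp ((-(a⁻¹ * Real.log (Real.sqrt (2 * a * (0 - t)))⁻¹)) • B)) x)))
    (hNS : IsClassicalNSSolutionOn (Iio 0) ν 0 u p)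
    {φ : EuclideanSpace ℝ (Fin 3) → ℝ} (hφc : Continuous φ)
    (hφs : HasCompactSupport φ) (hφ0 : ∀ x, 0 ≤ φ x) {x₀ : EuclideanSpace ℝ (Fin 3)}
    (hφ1 : ∀ x ∈ ball x₀ 1, φ x = 1) {t : ℝ} (ht : t < 0) :
    ((Real.sqrt (2 * a * (0 - t)))⁻¹)⁻¹ *
        ∫ y in ball ((Real.sqrt (2 * a * (0 - t)))⁻¹ •
          NormedSpace.exp ((-(a⁻¹ * Real.log (Real.sqrt (2 * a * (0 - t)))⁻¹)) • B) x₀)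
          (1 * (Real.sqrt (2 * a * (0 - t)))⁻¹), ‖U y‖ ^ 2 ≤
      ∫ x, φ x * ‖u t x‖ ^ 2 := by
  rw [← setIntegral_ball_norm_sq_physicalField ha hB hu ht x₀ 1]
  have ht' : t ∈ Iio (0 : ℝ) := ht
  have hu_c : Continuous (u t) := (hNS.contDiff_velocity ht').continuous
  have cg : Continuous fun x => ‖u t x‖ ^ 2 := hu_c.norm.pow 2
  have i1 : Integrable fun x => φ x * ‖u t x‖ ^ 2 :=
    (hφc.mul cg).integrable_of_hasCompactSupport hφs.mul_right
  rw [← integral_indicator measurableSet_ball]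
  refine integral_mono ((integrable_indicator_iff measurableSet_ball).2
    ((cg.continuousOn.integrableOn_compact (isCompact_closedBall x₀ 1)).mono_set ball_subset_closedBall)) i1 fun x => ?_
  by_cases hx : x ∈ ball x₀ 1
  · rw [indicator_of_mem hx, hφ1 x hx, one_mul]
  · rw [indicator_of_notMem hx]
    exact mul_nonneg (hφ0 x) (by positivity)

/-- **The local energy at a fixed time through a bounded cut-off**: `∫ φ‖u(t)‖² ≤ B₀ λ⁻¹ ∫_{B(z_t, Rλ)} ‖U‖²` for
`|φ| ≤ B₀` vanishing off `B(x₀, R)`, `t < 0`. [folklore] -/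
theorem integral_cutoff_physicalField_le (ha : 0 < a) (hB : ∀ x, inner ℝ (B x) x = 0)
    (hu : ∀ (t : ℝ) (x : EuclideanSpace ℝ (Fin 3)), u t x =
      (Real.sqrt (2 * a * (0 - t)))⁻¹ • (NormedSpace.exp ((a⁻¹ * Real.log (Real.sqrt (2 * a * (0 - t)))⁻¹) • B))
        (U ((Real.sqrt (2 * a * (0 - t)))⁻¹ •
          (NormedSpace.exp ((-(a⁻¹ * Real.log (Real.sqrt (2 * a * (0 - t)))⁻¹)) • B)) x)))
    (hNS : IsClassicalNSSolutionOn (Iio 0) ν 0 u p)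
    {φ : EuclideanSpace ℝ (Fin 3) → ℝ} (hφc : Continuous φ)
    (hφs : HasCompactSupport φ) {x₀ : EuclideanSpace ℝ (Fin 3)} {R B₀ : ℝ} (hφB : ∀ x, |φ x| ≤ B₀)
    (hφ0 : ∀ x, x ∉ ball x₀ R → φ x = 0) {t : ℝ} (ht : t < 0) :
    ∫ x, φ x * ‖u t x‖ ^ 2 ≤
      B₀ * (((Real.sqrt (2 * a * (0 - t)))⁻¹)⁻¹ *
        ∫ y in ball ((Real.sqrt (2 * a * (0 - t)))⁻¹ •
          NormedSpace.exp ((-(a⁻¹ * Real.log (Real.sqrt (2 * a * (0 - t)))⁻¹)) • B) x₀)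
          (R * (Real.sqrt (2 * a * (0 - t)))⁻¹), ‖U y‖ ^ 2) := by
  have ht' : t ∈ Iio (0 : ℝ) := ht
  have hu_c : Continuous (u t) := (hNS.contDiff_velocity ht').continuous
  have cg : Continuous fun x => ‖u t x‖ ^ 2 := hu_c.norm.pow 2
  have h := integral_weight_mul_le hφB hφ0 cg (fun x => by positivity)
    ((hφc.mul cg).integrable_of_hasCompactSupport hφs.mul_right)
  refine h.trans (le_of_eq ?_)
  rw [setIntegral_ball_norm_sq_physicalField ha hB hu ht x₀ R]

end Slices

end LocalEnergyRescue

end Summit.NavierStokesRegularity.NavierStokesRegularity.Theorems.CoriolisHead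

end
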